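import Summits.Langlands.Langlands.Statement
import Summits.Langlands.Langlands.Theorems.BaseFieldAscentReciprocityTRCMGoodCMQuadratic
import Summits.Langlands.Langlands.Theorems.BaseFieldAscentReciprocityTRCMStubDescentOfAutomorphy
import Summits.Langlands.Langlands.Theorems.BaseFieldAscentReciprocityTRCMTwistMatching
import Summits.Langlands.Langlands.Theorems.BaseFieldAscentReciprocityTRCMDeRhamRestrictOfLocal
import Summits.Langlands.Langlands.Theorems.BaseFieldAscentReciprocityTRCMArchimedeanDescentFacts
import Summits.Langlands.Langlands.Theorems.BaseFieldAscentReciprocityTRCMStubDeRhamBaseChangeLocal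
import Literature.NumberTheory.Automorphic.GLnAdelicStructureProofs
import HarnessLib

/-!
# Weak direction (B) over totally real fields from reciprocity over CM fields
# (crux `ReciprocityTRCM`, stmt-Langlands-1093, line `registered`; `--supports` helper)

Support file (closes nothing).  This is the former one-piece stub 5 `stub_weakGalToAutTRofCM` of the
registered skeleton `Cruxes/ReciprocityTRCM/Lines/pieces.lean`, DERIVED (lead reshape, cycle 1; kernel-checked
in the skeleton as `weakGalToAutTRofCM_of_pieces`) and now made IMPORTABLE and item-exact: its only
hypotheses are the statement of item stmt-Langlands-18032 `BaseFieldAscent.ArthurClozelCuspidalDescent`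
VERBATIM (Arthur–Clozel 1989 Ch. 3 Thm. 4.2 (d): cuspidal descent of prime degree, a.e. form; definitionally
the Literature fact `cuspidal_descent_cyclic`) and the Literature named fact
`ArthurClozel1989_strongLifting_archimedean` (Ch. 3 Thm. 5.1, archimedean clause).  Everything else is a
landed theorem of this line: a good CM quadratic `E/F` for `ρ` (`stub_exists_goodCMQuadratic_of_deRhamRestriction`,
p153974, fed with the de Rham base-change plumbing `stub_deRham_restrictField_pinned_of_local`, p157558, and
the DISCHARGED Brinon–Conrad fact `stub_deRhamBaseChange_local` = `DeRhamBaseChange_holds`, p169357/p169021),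
Galois-stability of the Satake data of the CM avatar (`stub_isGaloisStableSatakeAE_of_compatible_restrictField`,
p157885), L-algebraic quadratic descent over a totally real base (`quadraticDescentLAlgebraic_of_isTotallyReal`,
p162079) and twist-matching after descent (`stub_twistMatchingOfQuadraticDescent`, p159395).

Statement (`weakGalToAutTR_of_reciprocityCM`): 18032 → AC-5.1-arch → reciprocity over all CM fields →
for every totally real `F`, every reciprocity datum `R` carrying (A) in every rank, every irreducible
`R`-geometric `ρ : Γ_F → GL_n(ℚ̄_ℓ)` is WEAKLY cuspidal automorphic (some L-algebraic cuspidal `π` over `F`,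
Satake–Frobenius compatible with `ρ` at almost all places).  Proof: choose a CM quadratic `E/F` keeping `ρ`
irreducible and geometric; reciprocity over `E` gives an L-algebraic cuspidal `P ↔ ρ|_E`; its Satake data are
`Gal(E/F)`-stable; descend to an L-algebraic `π₁` over `F`; match `ρ` with `π₁` or its quadratic twist.
Route-free (imports the Statement, not the route module).  No definitions; standard axioms.

## References
* J. Arthur, L. Clozel, *Simple algebras, base change, and the advanced theory of the trace formula*,
  Ann. of Math. Stud. 120 (1989), Ch. 3 Thm. 4.2 (d), Thm. 5.1. [ArthurClozelAMS120]
* O. Brinon, B. Conrad, *CMI summer school notes on p-adic Hodge theory* (2009), Prop. 6.3.8. [BrinonConrad2009]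
-/

noncomputable section

set_option linter.dupNamespace false -- project-wide option (lakefile weak.linter.dupNamespace); `Summit.Langlands.Langlands` is the mandated namespace

open scoped MatrixGroups NumberField
open NumberField IsDedekindDomain Filter
open Literature.NumberTheory.Automorphic Literature.NumberTheory.GaloisRepresentations
open Summit.Langlands

namespace Summit.Langlands.Langlands.Theorems.ReciprocityTRCM

/-- **Weak (B) over totally real fields from reciprocity over CM fields** (former stub 5 of line `pieces`,
item-exact form): Arthur–Clozel cuspidal descent (item stmt-Langlands-18032, verbatim) → the archimedean
clause of strong lifting (named fact) → reciprocity over every CM field → for every totally real `F` and every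
reciprocity datum `R` with (A) in all ranks, every irreducible `R`-geometric `ρ` is Satake–Frobenius compatible
a.e. with some L-algebraic cuspidal `π` of `GL_n(𝔸_F)`.
[cite: ArthurClozelAMS120, Ch. 3 Thm. 4.2 (d) and Thm. 5.1] [cite: BrinonConrad2009, Prop. 6.3.8] -/
theorem weakGalToAutTR_of_reciprocityCM
    (hdesc : ∀ (n : ℕ) (F E : Type) [Field F] [NumberField F] [Field E] [NumberField E] [Algebra F E] [IsGalois F E] (hF : Literature.NumberTheory.Automorphic.isCompact_glFiniteIntegralLevel n F) (hE : Literature.NumberTheory.Automorphic.isCompact_glFiniteIntegralLevel n E), IsCyclic (E ≃ₐ[F] E) → (Module.finrank F E).Prime → ∀ P : Literature.NumberTheory.Automorphic.CuspidalAutomorphicRepData n E hE, (∀ᶠ w : IsDedekindDomain.HeightOneSpectrum (NumberField.RingOfIntegers E) in Filter.cofinite, ∀ w' : IsDedekindDomain.HeightOneSpectrum (NumberField.RingOfIntegers E), w'.asIdeal.under (NumberField.RingOfIntegers F) = w.asIdeal.under (NumberField.RingOfIntegers F) → ∀ α : Multiset ℂ, P.1.HasSatakeParamAt w α → P.1.HasSatakeParamAt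 w' α) → ∃ π : Literature.NumberTheory.Automorphic.CuspidalAutomorphicRepData n F hF, ∀ᶠ w : IsDedekindDomain.HeightOneSpectrum (NumberField.RingOfIntegers E) in Filter.cofinite, ∀ (v : IsDedekindDomain.HeightOneSpectrum (NumberField.RingOfIntegers F)) (α : Multiset ℂ), w.asIdeal.under (NumberField.RingOfIntegers F) = v.asIdeal → π.1.HasSatakeParamAt v α → P.1.HasSatakeParamAt w (α.map (· ^ w.asIdeal.inertiaDeg (NumberField.RingOfIntegers F))))
    (harch : Literature.NumberTheory.Automorphic.ArthurClozel1989_strongLifting_archimedean) :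
    (∀ (F : Type) [Field F] [NumberField F], NumberField.IsCMField F → ∃ R : ReciprocityData F, ∀ n : ℕ, 0 < n → ∀ hcpt : Literature.NumberTheory.Automorphic.isCompact_glFiniteIntegralLevel n F, GlobalLanglandsCorrespondenceGLn n F R hcpt) → ∀ (F : Type) [Field F] [NumberField F], NumberField.IsTotallyReal F → ∀ R : ReciprocityData F, (∀ n : ℕ, 0 < n → ∀ hcpt : Literature.NumberTheory.Automorphic.isCompact_glFiniteIntegralLevel n F, AutomorphicToGalois n R hcpt) → ∀ (n : ℕ), 0 < n → ∀ (ℓ : ℕ) [Fact ℓ.Prime] (ι : PadicAlgCl ℓ ≃+* ℂ) (ρ : Literature.NumberTheory.GaloisRepresentations.FramedGaloisRep F (PadicAlgCl ℓ) n), ρ.toGaloisRep.IsIrreducible → IsGeometricFramed R ρ → ∀ hcpt : Literature.NumberTheory.Automorphic.isCompact_glFiniteIntegralLevel n F, ∃ π : Literature.NumberTheory.Automorphic.CuspidalAutomorphicRepData n F hcpt, π.1.IsLAlgebraic ∧ ∀ᶠ v : IsDedekindDomain.HeightOneSpectrum (NumberField.RingOfIntegers F) in cofinite, SatakeFrobCompatibleAt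 ι π.1 ρ v := by
  -- item 18032 IS the Literature fact `cuspidal_descent_cyclic` (predicates unfolded), definitionally
  have hdesc' : Literature.NumberTheory.Automorphic.cuspidal_descent_cyclic := hdesc
  have hGS := stub_isGaloisStableSatakeAE_of_compatible_restrictField
  have h5A2 := stub_twistMatchingOfQuadraticDescent
  -- de Rham-ness of the pinned data restricts along `E/F` (5G plumbing fed with the discharged 5L)
  have hdR := stub_deRham_restrictField_pinned_of_local stub_deRhamBaseChange_local
  have h5E := stub_exists_goodCMQuadratic_of_deRhamRestriction hdR
  have h5A1 := quadraticDescentLAlgebraic_of_isTotallyReal hdesc' harch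
  intro hCM F _ _ hTR R hA n hn ℓ _ ι ρ hirr hgeo hcpt
  obtain ⟨E, _, _, _, _, h2, hCME, hirrE, hgeoE⟩ := h5E F hTR R n hn ℓ ρ hirr hgeo
  obtain ⟨RE, hRE⟩ := hCM E hCME
  have hcptE : Literature.NumberTheory.Automorphic.isCompact_glFiniteIntegralLevel n E :=
    Literature.NumberTheory.Automorphic.isCompact_glFiniteIntegralLevel_holds n E
  obtain ⟨P, hPL, hcorr⟩ := (hRE n hn hcptE).2 ℓ ι (ρ.restrictField E) hirrE (hgeoE RE)
  have hsat : ∀ᶠ w : HeightOneSpectrum (𝓞 E) in cofinite,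
      SatakeFrobCompatibleAt ι P.1 (ρ.restrictField E) w := hcorr.1
  have hstab : Literature.NumberTheory.Automorphic.IsGaloisStableSatakeAE F P.1 :=
    hGS F E n hcptE ℓ ι P.1 ρ hsat
  obtain ⟨π₁, hπ₁L, hBC⟩ := h5A1 n F E hTR h2 hcpt hcptE P hPL hstab
  exact h5A2 n F E h2 R hcpt hcptE (hA n hn hcpt) ℓ ι ρ hirrE P π₁ hπ₁L hBC hsat

end Summit.Langlands.Langlands.Theorems.ReciprocityTRCM

end
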